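import Summits.QuantumFields.GaugeBoot.TiltedLinkRPPositivity
import Summits.QuantumFields.GaugeBoot.TiltedBoxSiteRP
import Literature.MathematicalPhysics.QuantumLattice.GaugeGroups
import HarnessLib

/-!
# Link-hyperplane reflection positivity on the 45°-tilted periodic box, axes `k ∉ {i, j}` (gauge-boot, L3(υ) part 6)

HONEST FRAMING (cell `pub-gaugeboot`, page 1 of every file): the venture produces certified bounds
on lattice expectations at stated coupling, gauge group, dimension and torus size; NOT a mass gap,
NOT a continuum limit, NOT a string tension; NOT Yang–Mills-summit-bearing (barriers
`FixedCouplingUltralocality`, `PerturbativeInvisibility`).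

The instance of `TiltedLinkRPPositivity.lean` on the tilted box
`TiltedSite d i j M_u M_v L = ℤ^d ⧸ {2M_u ∣ x_i + x_j, 2M_v ∣ x_i - x_j, L ∣ x_k (k ∉ {i, j})}` of
`TiltedBox.lean` along an axis `k ∉ {i, j}` of EVEN period `L = 2Q`, `Q ≥ 2`: the site frame
`isSiteFrame_tiltedBox` of `TiltedBoxSiteRP.lean` (reflection `x_k ↦ -x_k`, height `x_k mod 2Q`)
also carries the Osterwalder–Seiler reflection in the hyperplane `x_k = ½` MIDWAY BETWEEN LATTICE
LAYERS — on representatives `x_k ↦ 1 - x_k` (`tiltedBox_midReflect_mk`), the `k`-links crossing the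
hyperplanes `x_k = ½` and `x_k = Q + ½` reversed and inverted (`configMidReflect`).

* `tiltedBox_linkRP` — for a compact second countable `G`, continuous `ρ`, `β ≥ 0` and every
  bounded measurable `F` depending only on the links with both endpoints in
  `{1 ≤ x_k ≤ Q (mod 2Q)}`: `0 ≤ ∫ conj F(ΘU) · F(U) dμ_β(U)`;
* `tiltedBox_rLinkBlock_nonneg` — the link RP blocks are positive semidefinite;
* `tiltedBox_integral_comp_configMidReflect` — `μ_β` is invariant under the link reflection;
* `tiltedBox_linkRP_suN` / `tiltedBox_linkRP_uN` — the venture's gauge groups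
  `Matrix.specialUnitaryGroup (Fin N) ℂ` / `Matrix.unitaryGroup (Fin N) ℂ` with the fundamental
  representations (all instances found; not vacuous).

With `TiltedBox.lean` (`tiltedBox_diagonalRP`, diagonal mirror `x_i = x_j`, `M_v ≥ 2`),
`TiltedBoxSiteRP.lean` (`tiltedBox_siteRP`, site hyperplanes `x_k = 0`) and
`TiltedLatticeSymmetry.lean` (translations), the tilted periodic box now carries as kernel-checked
theorems ALL THREE reflection-positivity families of the lattice bootstrap (Kazakov–Zheng
arXiv:2203.11360 §3.1: site planes, link planes, diagonal planes) that are available on it: site and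
link planes orthogonal to every axis `k ∉ {i, j}` of even period `≥ 4`, diagonal planes `x_i = x_j`.
NOT available on this box: reflection POSITIVITY in site / link planes orthogonal to the axes `i`,
`j` themselves (Fröhlich–Israel–Lieb–Simon 1980 §3: "at the cost of losing the other RP"; the flips
`x_i ↦ -x_i`, `x_j ↦ -x_j` are symmetries of the square box `M_u = M_v`, but not reflections of
positive type). Nothing here concerns infinite volume, DLR states or Class B on `ℤ^d`.

References: K. Osterwalder, E. Seiler, Ann. Phys. 110 (1978) 440, §2; E. Seiler, LNP 159 (1982);
J. Fröhlich, R. Israel, E. H. Lieb, B. Simon, J. Stat. Phys. 22 (1980) 297, §3;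
V. Kazakov, Z. Zheng, arXiv:2203.11360 §3.1.
-/

noncomputable section

open MeasureTheory Complex QuotientAddGroup
open scoped ComplexOrder ComplexConjugate
open Literature.MathematicalPhysics.QuantumLattice

namespace Summit.QuantumFields.GaugeBoot

namespace TiltedRP

/-! ## The link reflection of the tilted box on representatives -/

section Frame

variable (d : ℕ) {i j k : Fin d} (Mu Mv L : ℕ)

/-- **The link reflection of the tilted box along the axis `k ∉ {i, j}` on representatives**:
`[x] ↦ [x_k ↦ 1 - x_k]` — the reflection in the hyperplane `x_k = ½`. -/
theorem tiltedBox_midReflect_mk (hki : k ≠ i) (hkj : k ≠ j) (x : Fin d → ℤ) :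
    midReflect (tiltedUnit d i j Mu Mv L) k (tiltedReflect d Mu Mv L hki hkj)
        (x : TiltedSite d i j Mu Mv L) =
      ((fun m => if m = k then 1 - x m else x m : Fin d → ℤ) : TiltedSite d i j Mu Mv L) := by
  unfold midReflect tiltedUnit
  rw [tiltedReflect_mk, ← QuotientAddGroup.mk_add]
  congr 1
  funext m
  simp only [Pi.add_apply, negHom_apply]
  by_cases hm : m = k
  · subst hm
    rw [if_pos rfl, if_pos rfl, Pi.single_eq_same]
    ring
  · rw [if_neg hm, if_neg hm, Pi.single_eq_of_ne hm, add_zero]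

/-- The height of the reflected class: `x_k ↦ 1 - x_k (mod L)`. -/
theorem tiltedCoord_midReflect (hki : k ≠ i) (hkj : k ≠ j) (q : TiltedSite d i j Mu Mv L) :
    tiltedCoord d Mu Mv L hki hkj (midReflect (tiltedUnit d i j Mu Mv L) k
        (tiltedReflect d Mu Mv L hki hkj) q) = 1 - tiltedCoord d Mu Mv L hki hkj q := by
  induction q using QuotientAddGroup.induction_on with
  | H x =>
    rw [tiltedBox_midReflect_mk, tiltedCoord_mk, tiltedCoord_mk]
    simp

end Frame

/-! ## The theorems -/

section Main

variable {d : ℕ} {i j k : Fin d} {Mu Mv Q N : ℕ} [NeZero Mu] [NeZero Mv] [NeZero Q]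
variable {G : Type*} [Group G] [TopologicalSpace G] [IsTopologicalGroup G] [CompactSpace G]
  [MeasurableSpace G] [BorelSpace G] [SecondCountableTopology G]
variable (ρ : G →* Matrix (Fin N) (Fin N) ℂ)

/-- **Link-hyperplane (Osterwalder–Seiler) reflection positivity of lattice Yang–Mills on the
45°-tilted periodic box, along an axis `k ∉ {i, j}` of even period `2Q`** (`Q ≥ 2`). For a compact
second countable `G`, continuous `ρ`, `β ≥ 0` and every bounded measurable `F` depending only on
the links with both endpoints in the closed half `{1 ≤ x_k ≤ Q (mod 2Q)}`:
`0 ≤ ∫ conj F(ΘU) · F(U) dμ_β(U)`, `Θ` the reflection in the hyperplane `x_k = ½` (`k`-links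
crossing `x_k = ½`, `x_k = Q + ½` reversed and inverted). -/
theorem tiltedBox_linkRP (hki : k ≠ i) (hkj : k ≠ j) (hQ : 2 ≤ Q) (hρ : Continuous ρ) {β : ℝ}
    (hβ : 0 ≤ β) (F : Config (TiltedSite d i j Mu Mv (2 * Q)) d G → ℂ) (hFm : Measurable F)
    (hFb : ∃ C : ℝ, ∀ U, ‖F U‖ ≤ C)
    (hFo : IsMidObservable (tiltedUnit d i j Mu Mv (2 * Q)) Q (tiltedCoord d Mu Mv (2 * Q) hki hkj) F) :
    0 ≤ ∫ U, conj (F (configMidReflect (tiltedUnit d i j Mu Mv (2 * Q)) k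
        (tiltedReflect d Mu Mv (2 * Q) hki hkj) U)) * F U ∂(gibbs ρ (tiltedUnit d i j Mu Mv (2 * Q)) β) :=
  (isSiteFrame_tiltedBox d Mu Mv hki hkj hQ).linkRP_integral_conj_mul_nonneg ρ hρ hβ F hFm hFb hFo

/-- **The link RP blocks of the tilted box are positive semidefinite** (`k ∉ {i, j}`, `L = 2Q`,
`Q ≥ 2`, `β ≥ 0`): for bounded measurable half-space observables `F_1, …, F_n` and `c ∈ ℂ^n`,
`0 ≤ ∑_{a,b} conj c_a · c_b · ⟨conj(F_a ∘ Θ) F_b⟩_β`. -/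
theorem tiltedBox_rLinkBlock_nonneg (hki : k ≠ i) (hkj : k ≠ j) (hQ : 2 ≤ Q) (hρ : Continuous ρ)
    {β : ℝ} (hβ : 0 ≤ β) {n : ℕ} (F : Fin n → Config (TiltedSite d i j Mu Mv (2 * Q)) d G → ℂ)
    (hFm : ∀ a, Measurable (F a)) (hFb : ∀ a, ∃ C : ℝ, ∀ U, ‖F a U‖ ≤ C)
    (hFo : ∀ a, IsMidObservable (tiltedUnit d i j Mu Mv (2 * Q)) Q
      (tiltedCoord d Mu Mv (2 * Q) hki hkj) (F a)) (c : Fin n → ℂ) :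
    0 ≤ ∑ a, ∑ b, conj (c a) * c b *
      ∫ U, conj (F a (configMidReflect (tiltedUnit d i j Mu Mv (2 * Q)) k
        (tiltedReflect d Mu Mv (2 * Q) hki hkj) U)) * F b U ∂(gibbs ρ (tiltedUnit d i j Mu Mv (2 * Q)) β) :=
  (isSiteFrame_tiltedBox d Mu Mv hki hkj hQ).linkRP_sum_mul_conj_integral_nonneg ρ hρ hβ F hFm hFb
    hFo c

/-- **The Wilson measure of the tilted box is invariant under the link reflection `x_k ↦ 1 - x_k`**
(`k ∉ {i, j}`, `L = 2Q`, `Q ≥ 2`; every real `β`, measurable real `F`). -/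
theorem tiltedBox_integral_comp_configMidReflect (hki : k ≠ i) (hkj : k ≠ j) (hQ : 2 ≤ Q)
    (hρ : Continuous ρ) (β : ℝ) {F : Config (TiltedSite d i j Mu Mv (2 * Q)) d G → ℝ}
    (hFm : Measurable F) :
    ∫ U, F (configMidReflect (tiltedUnit d i j Mu Mv (2 * Q)) k (tiltedReflect d Mu Mv (2 * Q) hki hkj) U)
        ∂(gibbs ρ (tiltedUnit d i j Mu Mv (2 * Q)) β) =
      ∫ U, F U ∂(gibbs ρ (tiltedUnit d i j Mu Mv (2 * Q)) β) :=
  (isSiteFrame_tiltedBox d Mu Mv hki hkj hQ).integral_comp_configMidReflect_gibbs ρ hρ β hFm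

end Main

/-! ## The venture's gauge groups -/

section GaugeGroups

variable {d : ℕ} {i j k : Fin d} {Mu Mv Q N : ℕ} [NeZero Mu] [NeZero Mv] [NeZero Q]

/-- **Link-hyperplane RP of `SU(N)` lattice Yang–Mills on the tilted box along an axis
`k ∉ {i, j}`** (fundamental representation; `L = 2Q`, `Q ≥ 2`, `β ≥ 0`; every `N`). -/
theorem tiltedBox_linkRP_suN (hki : k ≠ i) (hkj : k ≠ j) (hQ : 2 ≤ Q) {β : ℝ} (hβ : 0 ≤ β)
    (F : Config (TiltedSite d i j Mu Mv (2 * Q)) d (Matrix.specialUnitaryGroup (Fin N) ℂ) → ℂ)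
    (hFm : Measurable F) (hFb : ∃ C : ℝ, ∀ U, ‖F U‖ ≤ C)
    (hFo : IsMidObservable (tiltedUnit d i j Mu Mv (2 * Q)) Q (tiltedCoord d Mu Mv (2 * Q) hki hkj) F) :
    0 ≤ ∫ U, conj (F (configMidReflect (tiltedUnit d i j Mu Mv (2 * Q)) k
        (tiltedReflect d Mu Mv (2 * Q) hki hkj) U)) * F U
      ∂(gibbs (fundamentalRep (Fin N)) (tiltedUnit d i j Mu Mv (2 * Q)) β) := by
  haveI : SecondCountableTopology (Matrix (Fin N) (Fin N) ℂ) :=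
    inferInstanceAs (SecondCountableTopology (Fin N → Fin N → ℂ))
  haveI : SecondCountableTopology (Matrix.specialUnitaryGroup (Fin N) ℂ) :=
    Topology.IsEmbedding.subtypeVal.secondCountableTopology
  exact tiltedBox_linkRP (fundamentalRep (Fin N)) hki hkj hQ (continuous_fundamentalRep (Fin N))
    hβ F hFm hFb hFo

/-- **Link-hyperplane RP of `U(N)` lattice gauge theory on the tilted box along an axis
`k ∉ {i, j}`** (fundamental representation; `L = 2Q`, `Q ≥ 2`, `β ≥ 0`; every `N`, `U(1)`
included). -/
theorem tiltedBox_linkRP_uN (hki : k ≠ i) (hkj : k ≠ j) (hQ : 2 ≤ Q) {β : ℝ} (hβ : 0 ≤ β)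
    (F : Config (TiltedSite d i j Mu Mv (2 * Q)) d (Matrix.unitaryGroup (Fin N) ℂ) → ℂ)
    (hFm : Measurable F) (hFb : ∃ C : ℝ, ∀ U, ‖F U‖ ≤ C)
    (hFo : IsMidObservable (tiltedUnit d i j Mu Mv (2 * Q)) Q (tiltedCoord d Mu Mv (2 * Q) hki hkj) F) :
    0 ≤ ∫ U, conj (F (configMidReflect (tiltedUnit d i j Mu Mv (2 * Q)) k
        (tiltedReflect d Mu Mv (2 * Q) hki hkj) U)) * F U
      ∂(gibbs (unitaryFundamentalRep (Fin N) ℂ) (tiltedUnit d i j Mu Mv (2 * Q)) β) := by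
  haveI : SecondCountableTopology (Matrix (Fin N) (Fin N) ℂ) :=
    inferInstanceAs (SecondCountableTopology (Fin N → Fin N → ℂ))
  haveI : SecondCountableTopology (Matrix.unitaryGroup (Fin N) ℂ) :=
    Topology.IsEmbedding.subtypeVal.secondCountableTopology
  exact tiltedBox_linkRP (unitaryFundamentalRep (Fin N) ℂ) hki hkj hQ
    (continuous_unitaryFundamentalRep (n := Fin N) (𝕜 := ℂ)) hβ F hFm hFb hFo

end GaugeGroups

end TiltedRP

end Summit.QuantumFields.GaugeBoot
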